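import Summits.RiemannHypothesis.RiemannHypothesis.Theorems.TiltedLandingLaw421R3Lens1SideBlock

/-!
# SideBlockTol — SCRATCH v1 (lens-1 g10, (O10-2) RE-POINTED by director-rh g29 (CA920)(2)/(CA923); files-only, NOT an image, NOT filed)

WHAT DIED.  NEG 14 (CA904): (T) `RhW08.Lens1SideBlock.SideBlockDescentQ` AS TYPED is false (tp3-k1w: two huggers at height `0.99998·Im a`, the E
block ascends by 8.148).  CAND 4 (C6 g44, EQH-231-1864, exact; (α′)(β′)(γ′) pending): `RhW08.Lens1Pinning.TopPinning` AS TYPED is false — and, since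
`a = i` is `StrictlyIsolated` on that frame (nearest other upper zero `0.231 + i` at distance `1.0264 > 1 = Im a` from the foot centre), the SAME record
instantiates `¬ RhW08.Lens1SideBlock.IsolatedTopPinningQ` AS TYPED: the #1243 split variable (strict isolation = distance from the foot centre) does not
see the wall.  Every certified violation of (T), of T′c, of the petal cover and of `TopPinning` found so far carries an upper zero `c ≠ a` whose closed
Jensen disc TOUCHES `a`ʼs (`|Re a − Re c| ≤ Im a + Im c`) at height `Im c ≥ 0.995·Im a` (NEG 14: 0.99998; cx-A…F: ≥ 0.9999; cx-D pole clearance 0.1 ⇒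
≥ 0.995; EQH/SL rows: 1, 1 − 1.0e-5; C6 height-cap re-optimisation: violating at cap 1 − 1e-5, none at cap 1 − 1e-4), while the gen-8/9 census
(0 / 6 419 blocks) sampled hugger heights ≤ 0.99 only (`linktoy/sideblock3.py` :19).

THE REPAIR VARIABLE is therefore the one of the adopted stub-1 repair `TopPinningTol θ` (tenure g20 r0 `a49f39d13499f938`, (CA923)): a HEIGHT CAP on
disc-touchers.  This file (ONE import = landed Z #1243; namespace `RhW08.Lens1SideBlockTol`; 0 sorry):
* `LowTouchers θ f j a` — every other upper zero whose closed disc touches `a`ʼs has height `< (1 − θ)·Im a` (strict, so that the split below is EXACT);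
  `DiscIsolated f j a` — no other upper zero touches at all (the `k = 0` petal class: no chords).
* (T_θ) `SideBlockDescentTolQ θ` := (T) VERBATIM with the extra binder `LowTouchers θ f j a` — the located per-side block-descent law on the CAPPED
  isolated class (reuses `SideBlockDescentAt`/`BlockEnds`/(S) `PetalRealisationQ` BY NAME; NEG 14, cx-A…F, EQH are NOT instances for any θ > 5·10⁻³).
* the `k = 0` class (`DiscIsolated`: no toucher at all) needs NO law: it is Jensen-isolated, pinned by the landed
  `RhW08.Lens1PinningIso.pinning_of_jensenIsolated'` (`discIsolatedPinning_holds`, two lines) — so (T_θ)ʼs whole content is the CROSSING-toucher class.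
* the EXACT SPLIT of `TopPinningTol θ` (twin-of-scratch copy of g20ʼs two defs, replaced by the import when RSV-105 lands):
  `TopPinningTol θ ↔ IsolatedTopPinningTolQ θ ∧ NonIsolatedTopResidualTolQ θ ∧ BandClusterPinningQ θ` for `0 ≤ θ < 1` (K, proved), where
  (I_θ) = capped strictly-isolated tops pay AT `a`; (R_θ) = capped clustered tops (another upper zero in the closed Jensen disc, all touchers low) pay AT `a`
  (OPEN residual, as (R) was); (C_θ) = BAND-CLUSTER PINNING: a toucher in the height band `[(1−θ)·Im a, Im a]` exists ⇒ SOME zero of the band touching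
  `a` is `Pinned` (OPEN; = what C6 g44ʼs bench (CA923)(2)(i) hunts; certified on all 10 wall records at θ = 1/20, hunt floors +0.63/+0.50/+0.014 at
  θ = 1/20, 1/10, 1/4).
* (K) PROVED: `isolatedTopPinningTol_of_laws : SideBlockDescentTolQ θ → PetalRealisationQ → IsolatedTopPinningTolQ θ` (Z §4 verbatim with the cap
  threaded), `discIsolatedPinning_holds : DiscIsolatedPinningQ` (citation), and the assembled
  `topPinningTol_of_sideBlockTol : SideBlockDescentTolQ θ → PetalRealisationQ → NonIsolatedTopResidualTolQ θ → BandClusterPinningQ θ → TopPinningTol θ`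
  (`0 ≤ θ`), which composes with g20ʼs `regHungCut10S_of_topPinningTol` to the crux.
T′a/T′b/T′c are NOT conjuncts (C6 (B) l.9260 ≡ lens-1ʼs reading: two-sided 2-chord COVER ⟺ (T both) ∨ T′c, T′b automatic, T′c false on (T)-true
frames, and even COVER fails on the wall family — so no clause confined to the petal of `a` reaches pinning AT `a` there; the wall is (C_θ)ʼs).
HONEST LABEL: (T_θ), (S), (R_θ), (C_θ) OPEN; §K proved bookkeeping.  Nothing here bears on the truth of RH; RH is not proved; 33346/33347 OPEN;
checked ≠ landed ≠ proved.
-/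

noncomputable section

namespace RhW08.Lens1SideBlockTol

open Complex Set Metric Filter Topology
open scoped Real
open Literature.Topology.PlaneTopology Literature.Analysis.Complex
open Summit.RiemannHypothesis.RiemannHypothesis.Theorems.Splittings.JensenWindow
open RhIdea6.G17.W07C7 RhIdea6.G17.W07C7.Rev6 RhIdea6.G18.W07C8.Law421BirthS RhIdea6.G19.W07C11.Seam
open RhIdea6.G20.W07C12.Frac RhIdea6.G20.W07C12.StColP RhW07.C12.FieldSplit RhIdea6.G21.W07C13.TentMax
open RhW07.C14.TwoSided RhW07.C14.Classes RhW07.C14.Lineage RhW07.C14.Booking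
open RhW07.C13.Heredity RhIdea6.G22.W07C15pre.Injection RhW07.E3.Cell RhW07.E3.Lit
open RhW08.Round1 RhW08.StSwap RhW08.Round2 RhW08.QuadW RhW08.SealSwapQ RhW08.SealSwap RhW08.SuccB RhW08.SuccSplit
open RhW08.SuccTheft RhW08.Column RhW08.Hurwitz RhW08.ClusterQ RhW08.ClusterQM RhW08.NewtonDoor RhW08.NewtonDoorGenusOne RhW08.PurseP
open RhW08.Lens1SignCut RhW08.Lens1Coverage RhW08.IsolatedTilt RhW08.Lens1Pinning RhW08.Lens1PinningIso
open RhW08.Lens1ArcSign RhW08.Lens1ValueCycle RhW08.Lens1PieceFramework RhW08.Lens1SideBlock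

/-! ## §0 Twin-of-scratch: g20ʼs `Pinned` / `TopPinningTol` (r0 `a49f39d13499f938` :35, :41 VERBATIM; to be replaced by the import of RSV-105) -/

/-- (= `RhW08.Lens1PinningTol.Pinned`, g20 r0 :35) the `TopPinning` disjunction read at `b`.  Syntactically identical to `RhW08.Lens1SideBlock.Pays`. -/
def Pinned (f : ℂ → ℂ) (j : ℕ) (b : ℂ) : Prop :=
  (∃ w : ℂ, iteratedDeriv (j + 1) f w = 0 ∧ w.im ≠ 0 ∧ NestedStep b w) ∨ (∃ x : ℝ, |x - b.re| ≤ b.im ∧ NLEventOf f j x)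

/-- (= `RhW08.Lens1PinningTol.TopPinningTol`, g20 r0 :41) TOP-OF-CLUSTER PINNING WITH HEIGHT TOLERANCE `θ`. -/
def TopPinningTol (θ : ℝ) : Prop :=
  ∀ (η : ℝ) (f : ℂ → ℂ) (x₀ s hmax R Hs : ℝ) (B : ℕ), EngineHyps5 2 η f x₀ s hmax R Hs B → ∀ (j : ℕ) (a : ℂ),
    iteratedDeriv j f a = 0 → 0 < a.im → NoTallerToucher f j a →
    ∃ a' : ℂ, iteratedDeriv j f a' = 0 ∧ (1 - θ) * a.im ≤ a'.im ∧ a'.im ≤ a.im ∧ |a.re - a'.re| ≤ a.im + a'.im ∧ Pinned f j a'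

theorem pinned_iff_pays (f : ℂ → ℂ) (j : ℕ) (b : ℂ) : Pinned f j b ↔ Pays f j b := Iff.rfl

/-! ## §1 The cap -/

/-- LOW TOUCHERS (cap `θ`): every OTHER upper zero `c` of `f^{(j)}` whose closed Jensen disc touches `a`ʼs (`|Re a − Re c| ≤ Im a + Im c`) has height
`Im c < (1 − θ)·Im a`.  For `θ ≥ 0` this implies `NoTallerToucher`; `¬ LowTouchers θ` = a toucher in the band `[(1−θ)·Im a, ∞)`. -/
def LowTouchers (θ : ℝ) (f : ℂ → ℂ) (j : ℕ) (a : ℂ) : Prop :=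
  ∀ c : ℂ, iteratedDeriv j f c = 0 → 0 < c.im → c ≠ a → |a.re - c.re| ≤ a.im + c.im → c.im < (1 - θ) * a.im

/-- DISC-ISOLATED: no other upper zero of `f^{(j)}` has its closed Jensen disc touching `a`ʼs (the `k = 0` petal class). -/
def DiscIsolated (f : ℂ → ℂ) (j : ℕ) (a : ℂ) : Prop :=
  ∀ c : ℂ, iteratedDeriv j f c = 0 → 0 < c.im → c ≠ a → a.im + c.im < |a.re - c.re|

theorem lowTouchers_of_discIsolated {f : ℂ → ℂ} {j : ℕ} {a : ℂ} (h : DiscIsolated f j a) (θ : ℝ) : LowTouchers θ f j a :=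
  fun c hc hcpos hca htouch => absurd htouch (not_le.2 (h c hc hcpos hca))

theorem lowTouchers_mono {θ θ' : ℝ} (hθ : θ ≤ θ') {f : ℂ → ℂ} {j : ℕ} {a : ℂ} (hapos : 0 < a.im) (h : LowTouchers θ' f j a) :
    LowTouchers θ f j a :=
  fun c hc hcpos hca htouch => lt_of_lt_of_le (h c hc hcpos hca htouch) (by nlinarith)

theorem noTallerToucher_of_lowTouchers {θ : ℝ} (hθ : 0 ≤ θ) {f : ℂ → ℂ} {j : ℕ} {a : ℂ} (hapos : 0 < a.im) (h : LowTouchers θ f j a) :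
    NoTallerToucher f j a := by
  intro b hb hbim
  by_contra hle
  push Not at hle
  have hba : b ≠ a := fun hba => by rw [hba] at hbim; exact lt_irrefl _ hbim
  have := h b hb (hapos.trans hbim) hba hle
  nlinarith

/-! ## §2 The laws on the capped class -/

/-- ★ (T_θ) CAPPED SIDE-BLOCK DESCENT (OPEN): (T) of #1243 VERBATIM with the extra binder `LowTouchers θ f j a`.  NEG 14ʼs tp3-k1w, cx-A…F and the EQH
wall records all have a toucher above `0.995·Im a` and are NOT instances for `θ > 5·10⁻³`; the 6 419-block census lies inside the class for `θ ≤ 1/100`. -/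
def SideBlockDescentTolQ (θ : ℝ) : Prop :=
  ∀ (η : ℝ) (f : ℂ → ℂ) (x₀ s hmax R Hs : ℝ) (B : ℕ), EngineHyps5 2 η f x₀ s hmax R Hs B → ∀ (j : ℕ) (a : ℂ),
    iteratedDeriv j f a = 0 → 0 < a.im → NoTallerToucher f j a → StrictlyIsolated f j a → LowTouchers θ f j a →
    ∃ d0 > 0, ∃ E : Set ℝ, E.Finite ∧ ∀ δ ∈ Ioo 0 d0 \ E, SideBlockDescentAt f j a δ

/-- (T) implies (T_θ) for every `θ` (nothing benchmarked FOR (T) is lost), and (T_θ) is monotone: a larger cap is a weaker law. -/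
theorem sideBlockDescentTol_of_sideBlockDescent (hT : SideBlockDescentQ) (θ : ℝ) : SideBlockDescentTolQ θ :=
  fun η f x₀ s hmax R Hs B hE j a ha hapos hN hI _ => hT η f x₀ s hmax R Hs B hE j a ha hapos hN hI

theorem sideBlockDescentTol_mono {θ θ' : ℝ} (hθ : θ ≤ θ') (h : SideBlockDescentTolQ θ) : SideBlockDescentTolQ θ' :=
  fun η f x₀ s hmax R Hs B hE j a ha hapos hN hI hL =>
    h η f x₀ s hmax R Hs B hE j a ha hapos hN hI (lowTouchers_mono hθ hapos hL)

/-! ## §3 The three pieces of `TopPinningTol θ` -/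

/-- (I_θ) the CAPPED ISOLATED half: strictly isolated, all touchers low ⇒ `a` itself pays. -/
def IsolatedTopPinningTolQ (θ : ℝ) : Prop :=
  ∀ (η : ℝ) (f : ℂ → ℂ) (x₀ s hmax R Hs : ℝ) (B : ℕ), EngineHyps5 2 η f x₀ s hmax R Hs B → ∀ (j : ℕ) (a : ℂ),
    iteratedDeriv j f a = 0 → 0 < a.im → NoTallerToucher f j a → StrictlyIsolated f j a → LowTouchers θ f j a → Pays f j a

/-- (R_θ) the CAPPED CLUSTERED residual (OPEN): another upper zero in the closed Jensen disc, all touchers low ⇒ `a` itself pays. -/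
def NonIsolatedTopResidualTolQ (θ : ℝ) : Prop :=
  ∀ (η : ℝ) (f : ℂ → ℂ) (x₀ s hmax R Hs : ℝ) (B : ℕ), EngineHyps5 2 η f x₀ s hmax R Hs B → ∀ (j : ℕ) (a : ℂ),
    iteratedDeriv j f a = 0 → 0 < a.im → NoTallerToucher f j a → ¬ StrictlyIsolated f j a → LowTouchers θ f j a → Pays f j a

/-- ★ (C_θ) BAND-CLUSTER PINNING (OPEN; the wall class): a toucher of height `≥ (1−θ)·Im a` exists ⇒ SOME zero of the band touching `a` is pinned. -/
def BandClusterPinningQ (θ : ℝ) : Prop :=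
  ∀ (η : ℝ) (f : ℂ → ℂ) (x₀ s hmax R Hs : ℝ) (B : ℕ), EngineHyps5 2 η f x₀ s hmax R Hs B → ∀ (j : ℕ) (a : ℂ),
    iteratedDeriv j f a = 0 → 0 < a.im → NoTallerToucher f j a → ¬ LowTouchers θ f j a →
    ∃ a' : ℂ, iteratedDeriv j f a' = 0 ∧ (1 - θ) * a.im ≤ a'.im ∧ a'.im ≤ a.im ∧ |a.re - a'.re| ≤ a.im + a'.im ∧ Pinned f j a'

/-- (D) the DISC-ISOLATED sub-case of (I_θ) (every θ): no toucher at all ⇒ `a` pays. -/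
def DiscIsolatedPinningQ : Prop :=
  ∀ (η : ℝ) (f : ℂ → ℂ) (x₀ s hmax R Hs : ℝ) (B : ℕ), EngineHyps5 2 η f x₀ s hmax R Hs B → ∀ (j : ℕ) (a : ℂ),
    iteratedDeriv j f a = 0 → 0 < a.im → StrictlyIsolated f j a → DiscIsolated f j a → Pays f j a

/-! ## §4 (K) PROVED -/

/-- (K) EXACT SPLIT, forward: the three pieces assemble `TopPinningTol θ` (`0 ≤ θ`: in the low class the witness is `a' := a`). -/
theorem topPinningTol_of_split {θ : ℝ} (hθ : 0 ≤ θ) (hI : IsolatedTopPinningTolQ θ) (hR : NonIsolatedTopResidualTolQ θ)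
    (hC : BandClusterPinningQ θ) : TopPinningTol θ := by
  intro η f x₀ s hmax R Hs B hE j a ha hapos hN
  by_cases hL : LowTouchers θ f j a
  · have hp : Pays f j a := by
      by_cases hiso : StrictlyIsolated f j a
      · exact hI η f x₀ s hmax R Hs B hE j a ha hapos hN hiso hL
      · exact hR η f x₀ s hmax R Hs B hE j a ha hapos hN hiso hL
    refine ⟨a, ha, by nlinarith, le_rfl, ?_, (pinned_iff_pays f j a).2 hp⟩
    rw [sub_self, abs_zero]; linarith
  · exact hC η f x₀ s hmax R Hs B hE j a ha hapos hN hL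

/-- (K) EXACT SPLIT, backward (`θ < 1`): in the low class the only admissible witness of `TopPinningTol θ` is `a` itself. -/
theorem pays_of_topPinningTol_low {θ : ℝ} (hθ : θ < 1) (hP : TopPinningTol θ) {η : ℝ} {f : ℂ → ℂ} {x₀ s hmax R Hs : ℝ} {B : ℕ}
    (hE : EngineHyps5 2 η f x₀ s hmax R Hs B) {j : ℕ} {a : ℂ} (ha : iteratedDeriv j f a = 0) (hapos : 0 < a.im)
    (hN : NoTallerToucher f j a) (hL : LowTouchers θ f j a) : Pays f j a := by
  obtain ⟨a', ha', hlo, hhi, htouch, hpin⟩ := hP η f x₀ s hmax R Hs B hE j a ha hapos hN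
  by_cases haa : a' = a
  · rw [haa] at hpin; exact (pinned_iff_pays f j a).1 hpin
  · have ha'pos : 0 < a'.im := lt_of_lt_of_le (mul_pos (by linarith) hapos) hlo
    exact absurd hlo (not_le.2 (hL a' ha' ha'pos haa htouch))

theorem isolatedTol_of_topPinningTol {θ : ℝ} (hθ : θ < 1) (hP : TopPinningTol θ) : IsolatedTopPinningTolQ θ :=
  fun _ _ _ _ _ _ _ _ hE _ _ ha hapos hN _ hL => pays_of_topPinningTol_low hθ hP hE ha hapos hN hL

theorem residualTol_of_topPinningTol {θ : ℝ} (hθ : θ < 1) (hP : TopPinningTol θ) : NonIsolatedTopResidualTolQ θ :=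
  fun _ _ _ _ _ _ _ _ hE _ _ ha hapos hN _ hL => pays_of_topPinningTol_low hθ hP hE ha hapos hN hL

theorem bandCluster_of_topPinningTol {θ : ℝ} (hP : TopPinningTol θ) : BandClusterPinningQ θ :=
  fun η f x₀ s hmax R Hs B hE j a ha hapos hN _ => hP η f x₀ s hmax R Hs B hE j a ha hapos hN

/-- ★ (K) THE SPLIT IS EXACT on `0 ≤ θ < 1`. -/
theorem topPinningTol_iff_split {θ : ℝ} (h0 : 0 ≤ θ) (h1 : θ < 1) :
    TopPinningTol θ ↔ IsolatedTopPinningTolQ θ ∧ NonIsolatedTopResidualTolQ θ ∧ BandClusterPinningQ θ :=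
  ⟨fun h => ⟨isolatedTol_of_topPinningTol h1 h, residualTol_of_topPinningTol h1 h, bandCluster_of_topPinningTol h⟩,
    fun h => topPinningTol_of_split h0 h.1 h.2.1 h.2.2⟩

/-- ★★ (K) THE CAPPED CHAIN: (T_θ) and the realisation socket (S) give (I_θ) (Z §4 `isolatedTopPinning_of_laws` with the cap threaded; image Y and
part Hʼs `pinning_of_arcCount_cofinite` by name). -/
theorem isolatedTopPinningTol_of_laws {θ : ℝ} (hT : SideBlockDescentTolQ θ) (hS : PetalRealisationQ) : IsolatedTopPinningTolQ θ := by
  intro η f x₀ s hmax R Hs B hE j a ha hapos hN hI hL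
  obtain ⟨d₁, hd₁, E₁, hE₁, h₁⟩ := hT η f x₀ s hmax R Hs B hE j a ha hapos hN hI hL
  obtain ⟨d₂, hd₂, E₂, hE₂, h₂⟩ := hS η f x₀ s hmax R Hs B hE j a ha hapos hN hI
  by_cases hdeg : ∃ z : ℂ, DegeneratePayer f j a z
  · obtain ⟨z, hz⟩ := hdeg
    exact pays_of_degenerate hE hapos hz
  · refine pinning_of_arcCount_cofinite hE ha hapos ⟨min d₁ d₂, lt_min hd₁ hd₂, E₁ ∪ E₂, hE₁.union hE₂, fun δ hδ => ?_⟩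
    have hδ₁ : δ ∈ Ioo 0 d₁ \ E₁ := ⟨⟨hδ.1.1, lt_of_lt_of_le hδ.1.2 (min_le_left _ _)⟩, fun h => hδ.2 (Or.inl h)⟩
    have hδ₂ : δ ∈ Ioo 0 d₂ \ E₂ := ⟨⟨hδ.1.1, lt_of_lt_of_le hδ.1.2 (min_le_right _ _)⟩, fun h => hδ.2 (Or.inr h)⟩
    rcases h₂ δ hδ₂ with hz | ⟨F, pet, β, hM⟩
    · exact absurd hz hdeg
    · exact arcCountIneq_of_model hM (blockDescent_of_sideBlock hM.2.2.2.2.2 (h₁ δ hδ₁))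

/-- (K) the `k = 0` class is ALREADY PINNED IN THE TREE, law-free and socket-free: `DiscIsolated ⇒ JensenIsolated` (left disjunct) and
`RhW08.Lens1PinningIso.pinning_of_jensenIsolated'` (…R3Lens1PinningIsoB, landed).  Recorded so that no law is ever filed for this class: the
content of (T_θ)/(I_θ) is the class with at least one CROSSING toucher below the cap (crit-1ʼs partial-overlap «theft» population). -/
theorem discIsolatedPinning_holds : DiscIsolatedPinningQ :=
  fun _ _ _ _ _ _ _ _ hE _ _ ha hapos _ hD => pinning_of_jensenIsolated' hE ha hapos fun c hc hcpos hca => Or.inl (hD c hc hcpos hca)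

/-- (K) bookkeeping: the disc-isolated rung is a sub-case of (I_θ) for every `θ`. -/
theorem discIsolatedPinning_of_isolatedTol {θ : ℝ} (hI : IsolatedTopPinningTolQ θ) : DiscIsolatedPinningQ :=
  fun η f x₀ s hmax R Hs B hE j a ha hapos hiso hD =>
    hI η f x₀ s hmax R Hs B hE j a ha hapos
      (fun b hb hbim => hD b hb (hapos.trans hbim) (fun hba => by rw [hba] at hbim; exact lt_irrefl _ hbim)) hiso
      (lowTouchers_of_discIsolated hD θ)

/-- ★★★ (K) ASSEMBLED: the capped petal law, the socket and the two open residuals give `TopPinningTol θ` (`0 ≤ θ`); with g20ʼs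
`regHungCut10S_of_topPinningTol` (scratch r0) this reaches `RegHungCut10S` and the v14q′ drawer composition. -/
theorem topPinningTol_of_sideBlockTol {θ : ℝ} (hθ : 0 ≤ θ) (hT : SideBlockDescentTolQ θ) (hS : PetalRealisationQ)
    (hR : NonIsolatedTopResidualTolQ θ) (hC : BandClusterPinningQ θ) : TopPinningTol θ :=
  topPinningTol_of_split hθ (isolatedTopPinningTol_of_laws hT hS) hR hC

/-- (K) consistency with #1243: the dead law (T) would give (I_θ) for every θ through the same socket. -/
theorem isolatedTopPinningTol_of_sideBlock (hT : SideBlockDescentQ) (hS : PetalRealisationQ) (θ : ℝ) : IsolatedTopPinningTolQ θ :=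
  isolatedTopPinningTol_of_laws (sideBlockDescentTol_of_sideBlockDescent hT θ) hS

end RhW08.Lens1SideBlockTol
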